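import Mathlib
import Literature.NumberTheory.LFunctions.Zhang2022.Section15P4Phase
import Literature.NumberTheory.LFunctions.Zhang2022.Section15RhoAlgebra
import HarnessLib

/-!
# Zhang (2022) §15 p. 88: `ℛ₁*ℛ₁₁ = 1`, `ℛ₁*ℛ₁₂ = 2`, `ℛ₁*ℛ₁₃ = 1` at the rate `O(𝓛⁻⁵)`, from the
# values of `ℛ₁*` (u058) and `ℛ₁ⱼ` (u059)

Topic `Literature/NumberTheory/LFunctions/Zhang2022` (Landau–Siegel audit tree; verdict-neutral).
Y. Zhang, *Discrete mean estimates and the Landau–Siegel zero*, arXiv:2211.02515v1 (2022)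
[Zhang2022LandauSiegel] — an unrefereed manuscript under adjudication (cell siegel-zhang, D-0069,
discharge lane, node `Skeleton.Ded1524`). §15 p. 88 (tex L4376–L4392): "By Lemma 5.8, `ℛ₁* =
β₁β₂L′(1,χ) + O(1/𝓛²⁴)` and `ℛ₁ⱼ = P₄^{β₃−βⱼ}/((β_{j+1}−βⱼ)(β_{j+2}−βⱼ)L′(1,χ)) + O(1/𝓛³)`. Hence,
by direct calculation, `ℛ₁*ℛ₁₁ = 1 + O(1/𝓛)`, `ℛ₁*ℛ₁₂ = 2 + O(1/𝓛)`, `ℛ₁*ℛ₁₃ = 1 + O(1/𝓛)`."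
`prod_rate5_of_values` carries the calculation out in the kernel, for ANY families `ℛ₁*(D,χ)`,
`ℛ₁ⱼ(D,χ)` satisfying the two value statements (the typed CLAIM nodes `Typed.Section15C.Step15_u058`,
`Step15_u059` instantiate them), and obtains the SHARPER rate `O(𝓛⁻⁵)` — the rate that the step to
(15.24) needs against the tree's crude `𝔞 ≪ 𝓛⁴` (`Section15Eval1524.eval1524_of_rates`); the
printed `O(1/𝓛)` alone does not suffice there without an upper bound on `𝔞`. Inputs from the tree:
`frakALowerBound_holds` ((A) ⇒ `𝔞 ≥ a₀`, whence `|L′(1,χ)| ≥ √a₀`, `sqrt_le_norm_deriv_of_frakA_ge`)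
and `Lemma31.norm_deriv_LFunction_le_near_one` (`|L′(1,χ)| ≤ 4e^{9/2}𝓛²`); the algebra of the
shifts (`Section15RhoAlgebra`) and the phases of `P₄^{β₃−βⱼ}` (`Section15P4Phase`).

WHAT THIS IS NOT: a proof of u058/u059 themselves, nor any claim about Theorems 1–2 of the
manuscript or Landau–Siegel zeros.

## References
* Y. Zhang, arXiv:2211.02515v1 (2022), §15 p. 88; §5 Lemma 5.7; §2 (2.13), (2.31).
  [cite: Zhang2022LandauSiegel, §15 p.88]
-/

noncomputable section

open Complex Real ComplexConjugate
open Literature.NumberTheory.LFunctions.Zhang2022.Skeleton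

namespace Literature.NumberTheory.LFunctions.Zhang2022.Ded1524

/-- `log D ≥ M` once `D ≥ ⌈e^M⌉`. [folklore] -/
private theorem le_ell_of_ceil_exp_le' {M : ℝ} {D : ℕ} (hD : ⌈Real.exp M⌉₊ ≤ D) : M ≤ ell D := by
  have h : Real.exp M ≤ D := le_trans (Nat.le_ceil _) (by exact_mod_cast hD)
  exact (Real.le_log_iff_exp_le (lt_of_lt_of_le (Real.exp_pos _) h)).mpr h

/-- The index convention `βⱼ`, `j mod 3`: `β₁, β₂, β₃, β₄ = β₁, β₅ = β₂`.
[cite: Zhang2022LandauSiegel, §8 p.17] -/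
private theorem betaJ_vals (c' : ℝ) (D : ℕ) :
    betaJ c' D 1 = beta1 c' D ∧ betaJ c' D 2 = beta2 c' D ∧ betaJ c' D 3 = beta3 c' D ∧
      betaJ c' D 4 = beta1 c' D ∧ betaJ c' D 5 = beta2 c' D := by
  simp [betaJ]

/-- **Under (A), `|L′(1,χ)| ≥ √a₀`** where `a₀` is the tree's lower bound for `𝔞` (`frakALowerBound_holds`:
`𝔞 = (6/π²)L′(1,χ)²∏_{q∣D} q/(q+1) ≥ a₀`, and `(6/π²)∏ ≤ 1`, `(Re L′)² ≤ |L′|²`).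
[cite: Zhang2022LandauSiegel, §2 p.6] -/
theorem sqrt_le_norm_deriv_of_frakA_ge {D : ℕ} [NeZero D] (χ : DirichletCharacter ℂ D) {a₀ : ℝ}
    (h : a₀ ≤ frakA χ) : Real.sqrt a₀ ≤ ‖deriv χ.LFunction 1‖ := by
  have hprod : ∏ p ∈ D.primeFactors, ((p : ℝ) / (p + 1)) ≤ 1 :=
    Finset.prod_le_one (fun p _ => by positivity) fun p _ => by
      rw [div_le_one (by positivity)]; linarith
  have hπ : 6 / π ^ 2 ≤ 1 := by
    rw [div_le_one (by positivity)]; nlinarith [Real.pi_gt_three]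
  have hre : (deriv χ.LFunction 1).re ^ 2 ≤ ‖deriv χ.LFunction 1‖ ^ 2 := by
    rw [← sq_abs]; gcongr; exact Complex.abs_re_le_norm _
  have hA : frakA χ ≤ ‖deriv χ.LFunction 1‖ ^ 2 := by
    rw [frakA, Lemma171.frakA]
    calc 6 / π ^ 2 * (deriv χ.LFunction 1).re ^ 2 * ∏ p ∈ D.primeFactors, ((p : ℝ) / (p + 1))
        ≤ 1 * ‖deriv χ.LFunction 1‖ ^ 2 * 1 := by gcongr
      _ = ‖deriv χ.LFunction 1‖ ^ 2 := by ring
  calc Real.sqrt a₀ ≤ Real.sqrt (‖deriv χ.LFunction 1‖ ^ 2) := Real.sqrt_le_sqrt (h.trans hA)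
    _ = ‖deriv χ.LFunction 1‖ := Real.sqrt_sq (norm_nonneg _)


section Assembly

variable (c' : ℝ) {D : ℕ}

/-- `α = π𝓛⁻⁹` and `θ := c′α𝓛` has `|θ| = |c′|π𝓛⁻⁸`. [cite: Zhang2022LandauSiegel, §2 (2.10)] -/
private theorem alpha_theta (hℓ : 0 < ell D) :
    alpha D = π / ell D ^ 9 ∧ |c' * alpha D * ell D| = |c'| * π / ell D ^ 8 := by
  have hα : alpha D = π / ell D ^ 9 := by rw [alpha, bigP, Real.log_exp]
  have hα0 : 0 ≤ alpha D := by rw [hα]; positivity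
  refine ⟨hα, ?_⟩
  rw [abs_mul, abs_mul, abs_of_nonneg hα0, abs_of_nonneg hℓ.le, hα]
  field_simp

/-- `|θ| ≤ 1/14` once `𝓛 ≥ 14|c′|π + 1`. [cite: Zhang2022LandauSiegel, §2 (2.10)] -/
private theorem theta_small (hℓ : 14 * |c'| * π + 1 ≤ ell D) (hℓ1 : 1 ≤ ell D) :
    |c' * alpha D * ell D| ≤ 1 / 14 := by
  have hℓ0 : 0 < ell D := by linarith
  rw [(alpha_theta c' hℓ0).2, div_le_div_iff₀ (by positivity) (by norm_num)]
  have h8 : ell D ≤ ell D ^ 8 := by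
    calc ell D = ell D ^ 1 := (pow_one _).symm
      _ ≤ ell D ^ 8 := pow_le_pow_right₀ hℓ1 (by norm_num)
  nlinarith [abs_nonneg c', Real.pi_pos]

variable {c'}

/-- **§15 p.88 u060–u062 at the rate `O(𝓛⁻⁵)`, from u058–u059.** If (u058) `ℛ₁* = β₁β₂L′(1,χ) +
O(𝓛⁻²⁴)` and (u059) `ℛ₁ⱼ = P₄^{β₃−βⱼ}/((β_{j+1}−βⱼ)(β_{j+2}−βⱼ)L′(1,χ)) + O(𝓛⁻³)` (`1 ≤ j ≤ 3`,
indices mod 3), then `ℛ₁*ℛ₁₁ = 1 + O(𝓛⁻⁵)`, `ℛ₁*ℛ₁₂ = 2 + O(𝓛⁻⁵)`, `ℛ₁*ℛ₁₃ = 1 + O(𝓛⁻⁵)` — for ANY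
families `ℛ₁*(D,χ)`, `ℛ₁ⱼ(D,χ)` (the typed slices instantiate them). Ingredients: the tree's
`frakALowerBound_holds` ((A) ⇒ `𝔞 ≥ a₀`, whence `|L′(1,χ)| ≥ √a₀`) and
`Lemma31.norm_deriv_LFunction_le_near_one` (`|L′(1,χ)| ≤ 4e^{9/2}𝓛²`), the ratios
`β₁β₂/((β_{j+1}−βⱼ)(β_{j+2}−βⱼ)) = (1−5θ)/(1+7θ), −2(1+θ)/(1+7θ), 1` (`θ = c′α𝓛 = c′π𝓛⁻⁸`) and the
phases `P₄^{β₃−βⱼ} = 1, −1, 1 + O(α𝓛³)`. The printed claim is the weaker `O(1/𝓛)`; this rate is what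
the step to (15.24) consumes (`Ded1524.eval1524_of_rates`). [cite: Zhang2022LandauSiegel, §15 p.88] -/
theorem prod_rate5_of_values (c' : ℝ)
    {R : ∀ (D : ℕ) [NeZero D], DirichletCharacter ℂ D → ℕ → ℂ}
    {Rs : ∀ (D : ℕ) [NeZero D], DirichletCharacter ℂ D → ℂ}
    (h58 : ∃ C : ℝ, ForAllLarge fun D _ χ => AssumptionA D χ →
      ‖Rs D χ - beta1 c' D * beta2 c' D * deriv χ.LFunction 1‖ ≤ C / ell D ^ 24)
    (h59 : ∃ C : ℝ, ForAllLarge fun D _ χ => AssumptionA D χ → ∀ j ∈ ({1, 2, 3} : Finset ℕ),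
      ‖R D χ j - ((P4 D : ℝ) : ℂ) ^ (beta3 c' D - betaJ c' D j) /
        ((betaJ c' D (j + 1) - betaJ c' D j) * (betaJ c' D (j + 2) - betaJ c' D j) *
          deriv χ.LFunction 1)‖ ≤ C / ell D ^ 3) :
    ∃ C : ℝ, ForAllLarge fun D _ χ => AssumptionA D χ →
      ‖Rs D χ * R D χ 1 - 1‖ ≤ C / ell D ^ 5 ∧ ‖Rs D χ * R D χ 2 - 2‖ ≤ C / ell D ^ 5 ∧
        ‖Rs D χ * R D χ 3 - 1‖ ≤ C / ell D ^ 5 := by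
  obtain ⟨C₁, h58⟩ := h58
  obtain ⟨C₂, h59⟩ := h59
  obtain ⟨a₀, ha₀, hA⟩ := frakALowerBound_holds
  set m₀ : ℝ := Real.sqrt a₀ with hm₀
  have hm₀pos : 0 < m₀ := Real.sqrt_pos.mpr ha₀
  set K : ℝ := 4 * |C₁| / (π ^ 2 * m₀) + |C₁| * |C₂| + 16 * π ^ 2 * Real.exp (9 / 2) * |C₂| +
    24 * |c'| * π + 2 * ((5 * |c'| * (π + 521) + 1042) * π) with hK
  set M : ℝ := max 3 (14 * |c'| * π + 1) with hM
  have hT : ForAllLarge fun D _ _ => M ≤ ell D :=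
    ForAllLarge.of_le ⌈Real.exp M⌉₊ fun D _ _ hD _ _ => le_ell_of_ceil_exp_le' hD
  obtain ⟨D₀, h⟩ := ((h58.and h59).and hA).and hT
  refine ⟨K, D₀, fun D _ χ hD hq hp hAss => ?_⟩
  obtain ⟨⟨⟨e58, e59⟩, eA⟩, hMℓ⟩ := h D χ hD hq hp
  have g58 := e58 hAss
  have g59 := e59 hAss
  have gA := eA hAss
  have hℓ3 : 3 ≤ ell D := (le_max_left _ _).trans hMℓ
  have hℓc : 14 * |c'| * π + 1 ≤ ell D := (le_max_right _ _).trans hMℓ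
  have hℓ2 : 2 ≤ ell D := by linarith
  have hℓ1 : 1 ≤ ell D := by linarith
  have hℓ0 : 0 < ell D := by linarith
  obtain ⟨hα0, -, -⟩ := alpha_bounds hℓ2
  obtain ⟨hα, hθabs⟩ := alpha_theta c' hℓ0
  have hαpos : 0 < alpha D := by rw [hα]; positivity
  have hθ : |c' * alpha D * ell D| ≤ 1 / 14 := theta_small c' hℓc hℓ1
  have hθ' := abs_le.mp hθ
  have h1θ : 1 + c' * alpha D * ell D ≠ 0 := by intro h; linarith
  have h5θ : 1 - 5 * (c' * alpha D * ell D) ≠ 0 := by intro h; linarith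
  have h7θ : 1 + 7 * (c' * alpha D * ell D) ≠ 0 := by intro h; linarith
  -- `L′(1,χ)`
  set L : ℂ := deriv χ.LFunction 1 with hLdef
  have hLup : ‖L‖ ≤ 4 * Real.exp (9 / 2) * ell D ^ 2 := by
    have h := Lemma31.norm_deriv_LFunction_le_near_one χ (by rw [ell] at hℓ3; exact hℓ3) hp
      (w := 1) (by simp; positivity)
    calc ‖L‖ ≤ 2 * Real.exp (9 / 2) * (1 + Real.log D) * Real.log D := h
      _ ≤ 2 * Real.exp (9 / 2) * (ell D + ell D) * ell D := by rw [ell] at hℓ1 ⊢; gcongr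
      _ = 4 * Real.exp (9 / 2) * ell D ^ 2 := by ring
  have hLlow : m₀ ≤ ‖L‖ := sqrt_le_norm_deriv_of_frakA_ge χ gA
  -- the shifts, ratios and phases
  obtain ⟨hν, hd1, hd2, hd3⟩ := beta_sizes c' D hα0 hθ
  obtain ⟨r1, r2, r3⟩ := beta_ratios c' D hαpos.ne' h1θ h5θ h7θ
  obtain ⟨bJ1, bJ2, bJ3, bJ4, bJ5⟩ := betaJ_vals c' D
  obtain ⟨w1, w2, w1n, w2n⟩ := P4_phases c' hℓ2
  obtain ⟨hr1, hr2⟩ := ratio_devs hθ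
  -- the u059 bounds at j = 1, 2, 3
  have g1 := g59 1 (by simp)
  have g2 := g59 2 (by simp)
  have g3 := g59 3 (by simp)
  rw [show (1:ℕ) + 1 = 2 from rfl, show (1:ℕ) + 2 = 3 from rfl, bJ1, bJ2, bJ3] at g1
  rw [show (2:ℕ) + 1 = 3 from rfl, show (2:ℕ) + 2 = 4 from rfl, bJ2, bJ3, bJ4] at g2
  rw [show (3:ℕ) + 1 = 4 from rfl, show (3:ℕ) + 2 = 5 from rfl, bJ3, bJ4, bJ5, sub_self,
    Complex.cpow_zero] at g3
  have hE1 : ‖Rs D χ - beta1 c' D * beta2 c' D * L‖ ≤ |C₁| / ell D ^ 24 :=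
    g58.trans (by gcongr; exact le_abs_self C₁)
  have e2 : ∀ x : ℝ, x ≤ C₂ / ell D ^ 3 → x ≤ |C₂| / ell D ^ 3 := fun x hx =>
    hx.trans (by gcongr; exact le_abs_self C₂)
  have P1 := prod_bound (r₀ := 1) (s := 1) hαpos hm₀pos hLlow hLup hd1 hν r1 hr1 w1n w1 hE1 (e2 _ g1)
  have P2 := prod_bound (r₀ := -2) (s := -1) hαpos hm₀pos hLlow hLup hd2 hν r2 hr2 w2n w2 hE1
    (e2 _ g2)
  have hr3 : beta1 c' D * beta2 c' D / ((beta1 c' D - beta3 c' D) * (beta2 c' D - beta3 c' D)) =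
      ((1 : ℝ) : ℂ) := by rw [r3]; norm_num
  have z1 : |(1 : ℝ) - 1| ≤ 0 := by simp
  have z2 : ‖(1 : ℂ)‖ = 1 := by simp
  have z3 : ‖(1 : ℂ) - 1‖ ≤ 0 := by simp
  have P3 := prod_bound (Rs := Rs D χ) (R := R D χ 3) (L := L)
    (d := (beta1 c' D - beta3 c' D) * (beta2 c' D - beta3 c' D)) (w := 1)
    (ν := beta1 c' D * beta2 c' D) (s := 1) (r := 1) (r₀ := 1) (δr := 0) (δw := 0)
    hαpos hm₀pos hLlow hLup hd3 hν hr3 z1 z2 z3 hE1 (e2 _ g3)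
  have hcol := collect (C₁ := C₁) (C₂ := C₂) hℓ1 hm₀pos hα hθabs
  rw [← hK] at hcol
  -- the common tail dominates each of the three tails
  have hαℓ3 : 0 ≤ alpha D * ell D ^ 3 := by positivity
  have hθ0 : 0 ≤ |c' * alpha D * ell D| := abs_nonneg _
  have hcπ : 0 ≤ |c'| * (π + 521) := mul_nonneg (abs_nonneg c') (by positivity)
  have big : 0 ≤ (5 * |c'| * (π + 521) + 1042) * (alpha D * ell D ^ 3) := by positivity
  have tl1 : (24 * |c' * alpha D * ell D| + |(1:ℝ)| * ((2 * |c'| * (π + 521) + 1042) *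
      (alpha D * ell D ^ 3))) ≤ 24 * |c' * alpha D * ell D| +
      2 * ((5 * |c'| * (π + 521) + 1042) * (alpha D * ell D ^ 3)) := by
    rw [abs_one, one_mul]
    have cmp : 2 * |c'| * (π + 521) + 1042 ≤ 2 * (5 * |c'| * (π + 521) + 1042) := by linarith
    have := mul_le_mul_of_nonneg_right cmp hαℓ3
    linarith
  have tl2 : (24 * |c' * alpha D * ell D| + |(-2:ℝ)| * ((5 * |c'| * (π + 521) + 521) *
      (alpha D * ell D ^ 3))) ≤ 24 * |c' * alpha D * ell D| +
      2 * ((5 * |c'| * (π + 521) + 1042) * (alpha D * ell D ^ 3)) := by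
    rw [show |(-2:ℝ)| = 2 by norm_num]
    have cmp : 5 * |c'| * (π + 521) + 521 ≤ 5 * |c'| * (π + 521) + 1042 := by linarith
    have := mul_le_mul_of_nonneg_right cmp hαℓ3
    linarith
  have tl3 : (0 + |(1:ℝ)| * 0 : ℝ) ≤ 24 * |c' * alpha D * ell D| +
      2 * ((5 * |c'| * (π + 521) + 1042) * (alpha D * ell D ^ 3)) := by
    simp only [abs_one, one_mul, add_zero]; positivity
  refine ⟨?_, ?_, ?_⟩
  · have e : ((1:ℝ) : ℂ) * 1 = 1 := by simp
    rw [e] at P1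
    exact P1.trans ((add_le_add le_rfl tl1).trans hcol)
  · have e : ((-2:ℝ) : ℂ) * (-1) = 2 := by push_cast; ring
    rw [e] at P2
    exact P2.trans ((add_le_add le_rfl tl2).trans hcol)
  · have e : ((1:ℝ) : ℂ) * 1 = 1 := by simp
    rw [e] at P3
    exact P3.trans ((add_le_add le_rfl tl3).trans hcol)

end Assembly

end Literature.NumberTheory.LFunctions.Zhang2022.Ded1524
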